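import Literature.Analysis.FluidPDE.AncientMildRepresentative
import Literature.Analysis.FluidPDE.KNSSAxisymmetricNoSwirl
import Literature.Analysis.FluidPDE.BlowupAncientSolutionProofs
import Literature.Analysis.FluidPDE.WeakGradientIBP
import Mathlib.MeasureTheory.Integral.DominatedConvergence
import HarnessLib

/-!
# Parasitic drifts in the duality-form class of bounded ancient mild solutions

Analysis/FluidPDE support file (all results proved) on the path from Koch–Nadirashvili–Seregin–
Šverák's Theorem 5.2 **as printed** (bounded weak solutions `u ∈ L^∞(ℝ³ × (−∞, 0))`, the named
fact `Literature.Analysis.FluidPDE.KNSS2009_liouville_axisymmetric_no_swirl` of `KNSSLiouville`)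
to the tree's slice-wise renderings `Literature.Analysis.FluidPDE.knss_axisymmetric_no_swirl`,
`Literature.Analysis.FluidPDE.knss_axisymmetric_no_swirl'` (`SelfSimilarLiouville`), whose
hypotheses ask for measurable *slices* of a bounded ancient mild solution only
(`Fluid.IsBoundedAncientMildSolution`: the two-time duality identity of Fabes–Jones–Rivière tested
against divergence-free fields, with Mathlib's junk value `0` for a non-integrable time
integrand). The gap between the two classes is the *spatially constant, time-dependent drift*
`b(t)` of KNSS 2009, §1 p. 3 ("Equation (1.1) has trivial non-constant solutions of the form
`u(x,t) = b(t)`, `p(x,t) = −b'(t)x` … the notion of weak solution does allow the parasitic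
solutions"): in the duality-form class `b` need not even be measurable. This file proves the two
structural facts about the class on which the reduction rests.

* **The heat regime** (`IsBoundedAncientMildSolution.integral_inner_eq_heatTest_of_not_intervalIntegrable`,
  `…integral_inner_eq_zero_of_not_intervalIntegrable`, `…exists_ae_eq_const_of_not_intervalIntegrable`):
  if, for some pair `s < t < 0` and some divergence-free test field `φ₀`, the nonlinear time
  integrand `τ ↦ ∫⟪u τ, (u τ·∇)e^{ν(t−τ)Δ}φ₀⟫` is **not** integrable on
  `(s, t)` — the only way the junk value can enter —, then, the nonlinear term being linear in the
  test field, the identity degenerates for *every* test field to the caloric relation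
  `∫⟪u t, φ⟫ = ∫⟪u s', e^{ν(t−s')Δ}φ⟫` for all `s' ≤ s`; letting `s' → −∞`
  (`‖e^{σΔ}φ‖_{L¹} ≤ K σ^{-1/2}` for divergence-free tests, `φᵢ = Σⱼ ∂ⱼ(xᵢφⱼ)`) all pairings of
  `u t` with divergence-free tests vanish, so the slice `u t` is a.e. constant (the `L^∞`
  annihilator lemma). Contrapositively, at a slice which is not a.e. constant every nonlinear
  time integrand ending at `t` is honestly integrable
  (`…intervalIntegrable_nonlinear_of_not_ae_const`).
* **The drift lemma** (`IsBoundedAncientMildSolution.add_timeConst_smul_of_ae_invariant`): adding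
  a drift `d(t) e` along a fixed vector `e`, with `d : ℝ → ℝ` merely bounded (no measurability),
  to a bounded ancient mild solution `u` gives again a bounded ancient mild solution, provided
  that for a.e. `τ < 0` either `d τ = 0` or the slice `u τ` is invariant under the translations
  along `e` (then the cross terms of the nonlinear integrand vanish: `∫⟪u τ, ∂ₑψ⟫ = 0` by
  invariance, `∫⟪e, (u τ·∇)ψ⟫ = 0` by weak divergence-freeness, `∫ ∂ₑψ = 0`). In particular
  (`isBoundedAncientMildSolution_timeConst`) **every** family of spatial constants `u(t, x) = b(t)`,
  measurable in `t` or not, is a bounded ancient mild solution of the duality-form class: the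
  witness that the slice-wise class is strictly larger than print's `L^∞(ℝ³ × (−∞, 0))`.

## References

* G. Koch, N. Nadirashvili, G. Seregin, V. Šverák, *Liouville theorems for the Navier–Stokes
  equations and applications*, Acta Math. 203 (2009) 83–105 = arXiv:0709.3599, §1 p. 3 (the
  parasitic solutions `u(x,t) = b(t)`), §3 p. 7 (`u = v + w + b(t)` for bounded weak solutions of
  the linear Stokes system), Thm 5.2 pp. 9–10. [KochNadirashviliSereginSverak2009]
* E. B. Fabes, B. F. Jones, N. M. Rivière, Arch. Rational Mech. Anal. 45 (1972), Thm. 2.1 (the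
  duality identity). [FabesJonesRiviere1972]
-/

noncomputable section

open MeasureTheory Set Function Filter Topology TopologicalSpace InnerProductSpace
open scoped RealInnerProductSpace NNReal ENNReal ContDiff

namespace Literature.Analysis.FluidPDE

variable {E : Type*} [NormedAddCommGroup E] [InnerProductSpace ℝ E] [FiniteDimensional ℝ E]
  [MeasurableSpace E] [BorelSpace E]

/-! ### Algebra of the heat flow on bounded continuous data, for every elapsed time -/

section HeatFlowAlgebra

variable {F : Type*} [NormedAddCommGroup F] [NormedSpace ℝ F]

/-- `e^{σΔ}(g + h) = e^{σΔ}g + e^{σΔ}h` on bounded continuous data, for every `σ` (for `σ ≤ 0` the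
flow is the identity by definition). [folklore] -/
theorem heatFlow_add_of_bound {g h : E → F} (hg : Continuous g) (hh : Continuous h) {Cg Ch : ℝ}
    (hCg : ∀ z, ‖g z‖ ≤ Cg) (hCh : ∀ z, ‖h z‖ ≤ Ch) (σ : ℝ) (x : E) :
    heatFlow (fun z => g z + h z) σ x = heatFlow g σ x + heatFlow h σ x := by
  rcases le_or_gt σ 0 with hσ | hσ
  · simp only [heatFlow_of_nonpos _ hσ]
  · simp only [heatFlow_of_pos _ hσ]
    exact UnboundedOperators.heatExtension_add_of_bound hg hh hCg hCh hσ x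

/-- `e^{σΔ}(g - h) = e^{σΔ}g - e^{σΔ}h` on bounded continuous data, for every `σ`. [folklore] -/
theorem heatFlow_sub_of_bound {g h : E → F} (hg : Continuous g) (hh : Continuous h) {Cg Ch : ℝ}
    (hCg : ∀ z, ‖g z‖ ≤ Cg) (hCh : ∀ z, ‖h z‖ ≤ Ch) (σ : ℝ) (x : E) :
    heatFlow (fun z => g z - h z) σ x = heatFlow g σ x - heatFlow h σ x := by
  rcases le_or_gt σ 0 with hσ | hσ
  · simp only [heatFlow_of_nonpos _ hσ]
  · simp only [heatFlow_of_pos _ hσ]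
    exact UnboundedOperators.heatExtension_sub_of_bound hg hh hCg hCh hσ x

/-- `e^{σΔ}(a • g) = a • e^{σΔ}g`, for every `σ`. [folklore] -/
theorem heatFlow_const_smul (a : ℝ) (g : E → F) (σ : ℝ) (x : E) :
    heatFlow (fun z => a • g z) σ x = a • heatFlow g σ x := by
  rcases le_or_gt σ 0 with hσ | hσ
  · simp only [heatFlow_of_nonpos _ hσ]
  · simp only [heatFlow_of_pos _ hσ]
    exact UnboundedOperators.heatExtension_const_smul a g σ x

/-- The heat flow commutes with translations, for every `σ` (both sides are the same integral).
[folklore] -/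
theorem heatFlow_comp_add_right_apply (g : E → F) (a : E) (σ : ℝ) (x : E) :
    heatFlow (fun z => g (z + a)) σ x = heatFlow g σ (x + a) := by
  rcases le_or_gt σ 0 with hσ | hσ
  · simp only [heatFlow_of_nonpos _ hσ]
  · simp only [heatFlow_of_pos _ hσ, UnboundedOperators.heatExtension_apply]
    congr 1
    funext y
    rw [sub_add_eq_add_sub]

/-- **Directional derivatives fall on the data, for all `σ`**: `∂ₑ(e^{σΔ}g)(x) = e^{σΔ}(∂ₑg)(x)`
for `g ∈ C¹_c`. [folklore] -/
theorem fderiv_heatFlow_apply {g : E → F} (hg : ContDiff ℝ 1 g) (hc : HasCompactSupport g)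
    (σ : ℝ) (x e : E) : fderiv ℝ (heatFlow g σ) x e = heatFlow (fun z => fderiv ℝ g z e) σ x := by
  rcases le_or_gt σ 0 with hσ | hσ
  · simp only [heatFlow_of_nonpos _ hσ]
  · simp only [heatFlow_of_pos _ hσ]
    exact UnboundedOperators.fderiv_heatExtension_apply_of_hasCompactSupport hg hc σ x e

end HeatFlowAlgebra

/-! ### The nonlinear time integrand of the duality identity -/

section Nonlinear

omit [FiniteDimensional ℝ E] [MeasurableSpace E] [BorelSpace E] in
/-- A test field is bounded. [folklore] -/
theorem _root_.Literature.Analysis.FunctionSpaces.IsTestFunctionOn.exists_norm_le {F : Type*}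
    [NormedAddCommGroup F] [NormedSpace ℝ F] {φ : E → F}
    (hφ : FunctionSpaces.IsTestFunctionOn (⊤ : Opens E) φ) : ∃ C : ℝ, ∀ x, ‖φ x‖ ≤ C :=
  hφ.contDiff.continuous.bounded_above_of_compact_support hφ.hasCompactSupport

/-- The field `x ↦ D(e^{νσΔ}φ)(x)[v x]` is integrable for a bounded measurable `v` and a test field
`φ` (the derivative falls on the data and the heat flow preserves integrability). [folklore] -/
theorem integrable_convect_heatTest {v : E → E} (hv : AEStronglyMeasurable v volume) {M : ℝ}
    (hM : ∀ x, ‖v x‖ ≤ M) {φ : E → E} (hφ : FunctionSpaces.IsTestFunctionOn (⊤ : Opens E) φ)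
    (ν σ : ℝ) : Integrable (fun x => convect v (heatTest ν φ σ) x) := by
  have hφ1 : ContDiff ℝ 1 φ := hφ.contDiff.of_le (by exact_mod_cast le_top)
  have hDφi : Integrable (fderiv ℝ φ) :=
    (hφ1.continuous_fderiv one_ne_zero).integrable_of_hasCompactSupport (hφ.hasCompactSupport.fderiv ℝ)
  have hD : ∀ x, fderiv ℝ (heatTest ν φ σ) x = heatFlow (fderiv ℝ φ) (ν * σ) x := fun x =>
    fderiv_heatFlow hφ1 hφ.hasCompactSupport _ x
  have hHi : Integrable (heatFlow (fderiv ℝ φ) (ν * σ)) := integrable_heatFlow hDφi _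
  have hg : Integrable (fun x => heatFlow (fderiv ℝ φ) (ν * σ) x (v x)) := by
    refine Integrable.mono' (hHi.norm.mul_const M) ?_ (Eventually.of_forall fun x => ?_)
    · exact isBoundedBilinearMap_apply.continuous.comp_aestronglyMeasurable
        (hHi.aestronglyMeasurable.prodMk hv)
    · exact (ContinuousLinearMap.le_opNorm _ _).trans
        (mul_le_mul_of_nonneg_left (hM x) (norm_nonneg _))
  refine hg.congr (Eventually.of_forall fun x => ?_)
  simp only [convect_apply, hD x]

/-- The nonlinear integrand `x ↦ ⟪v x, D(e^{νσΔ}φ)(x)[v x]⟫` is integrable for a bounded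
measurable `v` and a test field `φ`. [folklore] -/
theorem integrable_inner_convect_heatTest {v : E → E} (hv : AEStronglyMeasurable v volume) {M : ℝ}
    (hM : ∀ x, ‖v x‖ ≤ M) {φ : E → E} (hφ : FunctionSpaces.IsTestFunctionOn (⊤ : Opens E) φ)
    (ν σ : ℝ) : Integrable (fun x => ⟪v x, convect v (heatTest ν φ σ) x⟫) :=
  integrable_inner_of_aestronglyMeasurable_of_norm_le hv hM (integrable_convect_heatTest hv hM hφ ν σ)

/-- **The nonlinear integrand is additive in the test field**:
`∫⟪v, (v·∇)e^{νσΔ}(φ₁ + φ₂)⟫ = ∫⟪v, (v·∇)e^{νσΔ}φ₁⟫ + ∫⟪v, (v·∇)e^{νσΔ}φ₂⟫` for a bounded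
measurable `v` (all three integrands are honestly integrable). [folklore] -/
theorem integral_inner_convect_heatTest_add {v : E → E} (hv : AEStronglyMeasurable v volume) {M : ℝ}
    (hM : ∀ x, ‖v x‖ ≤ M) {φ₁ φ₂ : E → E} (hφ₁ : FunctionSpaces.IsTestFunctionOn (⊤ : Opens E) φ₁)
    (hφ₂ : FunctionSpaces.IsTestFunctionOn (⊤ : Opens E) φ₂) (ν σ : ℝ) :
    ∫ x, ⟪v x, convect v (heatTest ν (φ₁ + φ₂) σ) x⟫ =
      (∫ x, ⟪v x, convect v (heatTest ν φ₁ σ) x⟫) + ∫ x, ⟪v x, convect v (heatTest ν φ₂ σ) x⟫ := by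
  obtain ⟨C₁, hC₁⟩ := hφ₁.exists_norm_le
  obtain ⟨C₂, hC₂⟩ := hφ₂.exists_norm_le
  have h1 : ContDiff ℝ 1 φ₁ := hφ₁.contDiff.of_le (by exact_mod_cast le_top)
  have h2 : ContDiff ℝ 1 φ₂ := hφ₂.contDiff.of_le (by exact_mod_cast le_top)
  have hsum : heatTest ν (φ₁ + φ₂) σ = fun x => heatTest ν φ₁ σ x + heatTest ν φ₂ σ x :=
    funext fun x => heatFlow_add_of_bound hφ₁.contDiff.continuous hφ₂.contDiff.continuous hC₁ hC₂ _ x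
  have hd₁ : Differentiable ℝ (heatTest ν φ₁ σ) :=
    (contDiff_heatFlow h1 hφ₁.hasCompactSupport _).differentiable one_ne_zero
  have hd₂ : Differentiable ℝ (heatTest ν φ₂ σ) :=
    (contDiff_heatFlow h2 hφ₂.hasCompactSupport _).differentiable one_ne_zero
  have hD : ∀ x, fderiv ℝ (heatTest ν (φ₁ + φ₂) σ) x =
      fderiv ℝ (heatTest ν φ₁ σ) x + fderiv ℝ (heatTest ν φ₂ σ) x := fun x => by
    rw [hsum]
    exact fderiv_add (hd₁ x) (hd₂ x)
  rw [← integral_add (integrable_inner_convect_heatTest hv hM hφ₁ ν σ)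
    (integrable_inner_convect_heatTest hv hM hφ₂ ν σ)]
  refine integral_congr_ae (Eventually.of_forall fun x => ?_)
  simp only [convect_apply, hD x, add_apply, inner_add_right]

end Nonlinear

/-! ### The heat regime: a non-integrable nonlinear term forces a constant slice -/

section HeatRegime

variable {ν : ℝ} {u : ℝ → E → E} {M : ℝ}

omit [FiniteDimensional ℝ E] [MeasurableSpace E] [BorelSpace E] in
/-- The sum of two divergence-free `C¹` fields is divergence free (the divergence is the trace of
the derivative, which is additive). [folklore] -/
theorem _root_.Literature.Analysis.FluidPDE.VectorCalculus.IsDivFree.add_of_differentiable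
    {φ ψ : E → E} (hφ : VectorCalculus.IsDivFree φ) (hψ : VectorCalculus.IsDivFree ψ)
    (hφd : Differentiable ℝ φ) (hψd : Differentiable ℝ ψ) : VectorCalculus.IsDivFree (φ + ψ) := by
  intro x
  have h1 := hφ x
  have h2 := hψ x
  simp only [VectorCalculus.divergence] at h1 h2
  show LinearMap.trace ℝ E (fderiv ℝ (φ + ψ) x : E →ₗ[ℝ] E) = 0
  rw [fderiv_add (hφd x) (hψd x)]
  simp [h1, h2]

/-- **The degenerate (caloric) identity.** Let `u` be a bounded ancient mild solution with
measurable slices, `s < t < 0`, and suppose that for some divergence-free test field `φ₀` the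
nonlinear time integrand `τ ↦ ∫⟪u τ, (u τ·∇)e^{ν(t−τ)Δ}φ₀⟫` is *not* integrable on `(s, t)`. Then for
**every** divergence-free test field `φ` the two-time identity between `s` and `t` degenerates to
`∫⟪u t, φ⟫ = ∫⟪u s, e^{ν(t−s)Δ}φ⟫`: for `φ` with a non-integrable nonlinear term this is the
identity read with Mathlib's junk value `0`; for the others, `φ + φ₀` has a non-integrable
nonlinear term (the integrand is additive in the test field), and both sides are additive.
[folklore] -/
theorem IsBoundedAncientMildSolution.integral_inner_eq_heatTest_of_not_intervalIntegrable
    (hu : IsBoundedAncientMildSolution ν u) (hM : ∀ t < 0, ∀ x, ‖u t x‖ ≤ M)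
    (hmeas : ∀ t < 0, AEStronglyMeasurable (u t) volume) {s t : ℝ} (hst : s < t) (ht : t < 0)
    {φ₀ : E → E} (hφ₀ : FunctionSpaces.IsTestFunctionOn (⊤ : Opens E) φ₀) (hdiv₀ : VectorCalculus.IsDivFree φ₀)
    (hbad : ¬ IntervalIntegrable (fun τ => ∫ x, ⟪u τ x, convect (u τ) (heatTest ν φ₀ (t - τ)) x⟫) volume s t)
    {φ : E → E} (hφ : FunctionSpaces.IsTestFunctionOn (⊤ : Opens E) φ) (hdiv : VectorCalculus.IsDivFree φ) :
    ∫ x, ⟪u t x, φ x⟫ = ∫ x, ⟪u s x, heatTest ν φ (t - s) x⟫ := by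
  have hs : s < 0 := hst.trans ht
  -- the nonlinear time integrand of the identity between `s` and `t`, as a function of the test
  set G : (E → E) → ℝ → ℝ := fun ψ τ => ∫ x, ⟪u τ x, convect (u τ) (heatTest ν ψ (t - τ)) x⟫ with hG
  -- the two-time identity, force term removed
  have ident : ∀ {ψ : E → E}, FunctionSpaces.IsTestFunctionOn (⊤ : Opens E) ψ → VectorCalculus.IsDivFree ψ →
      ∫ x, ⟪u t x, ψ x⟫ = (∫ x, ⟪u s x, heatTest ν ψ (t - s) x⟫) + ∫ τ in s..t, G ψ τ := by
    intro ψ hψ hψdiv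
    have key := hu.1.2 s t hst ht ψ hψ hψdiv
    simpa only [hG, Pi.zero_apply, inner_zero_left, integral_zero,
      intervalIntegral.integral_zero, add_zero] using key
  -- the junk case
  have junk : ∀ {ψ : E → E}, FunctionSpaces.IsTestFunctionOn (⊤ : Opens E) ψ → VectorCalculus.IsDivFree ψ →
      ¬ IntervalIntegrable (G ψ) volume s t →
      ∫ x, ⟪u t x, ψ x⟫ = ∫ x, ⟪u s x, heatTest ν ψ (t - s) x⟫ := by
    intro ψ hψ hψdiv hψbad
    rw [ident hψ hψdiv, intervalIntegral.integral_undef hψbad, add_zero]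
  replace hbad : ¬ IntervalIntegrable (G φ₀) volume s t := hbad
  by_cases hgood : IntervalIntegrable (G φ) volume s t
  swap
  · exact junk hφ hdiv hgood
  -- `φ + φ₀` is a divergence-free test field with a non-integrable nonlinear term
  have hφ' : FunctionSpaces.IsTestFunctionOn (⊤ : Opens E) (φ + φ₀) := hφ.add_top hφ₀
  have hdiv' : VectorCalculus.IsDivFree (φ + φ₀) :=
    hdiv.add_of_differentiable hdiv₀ (hφ.contDiff.differentiable (by simp))
      (hφ₀.contDiff.differentiable (by simp))
  have hsumτ : ∀ τ < 0, G (φ + φ₀) τ = G φ τ + G φ₀ τ := fun τ hτ =>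
    integral_inner_convect_heatTest_add (hmeas τ hτ) (hM τ hτ) hφ hφ₀ ν (t - τ)
  have hbad' : ¬ IntervalIntegrable (G (φ + φ₀)) volume s t := by
    intro hsum
    apply hbad
    have hdiff := hsum.sub hgood
    rw [intervalIntegrable_iff] at hdiff ⊢
    refine hdiff.congr_fun (fun τ hτ => ?_) measurableSet_uIoc
    rw [uIoc_of_le hst.le] at hτ
    have hτ0 : τ < 0 := hτ.2.trans_lt ht
    simp only [hsumτ τ hτ0, add_sub_cancel_left]
  have e1 := junk hφ' hdiv' hbad'
  have e0 := junk hφ₀ hdiv₀ hbad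
  -- both sides are additive in the test field
  have hφi : Integrable φ := hφ.contDiff.continuous.integrable_of_hasCompactSupport hφ.hasCompactSupport
  have hφ₀i : Integrable φ₀ := hφ₀.contDiff.continuous.integrable_of_hasCompactSupport hφ₀.hasCompactSupport
  obtain ⟨C, hC⟩ := hφ.exists_norm_le
  obtain ⟨C₀, hC₀⟩ := hφ₀.exists_norm_le
  have lhs : ∫ x, ⟪u t x, (φ + φ₀) x⟫ = (∫ x, ⟪u t x, φ x⟫) + ∫ x, ⟪u t x, φ₀ x⟫ := by
    rw [← integral_add (integrable_inner_of_aestronglyMeasurable_of_norm_le (hmeas t ht) (hM t ht) hφi)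
      (integrable_inner_of_aestronglyMeasurable_of_norm_le (hmeas t ht) (hM t ht) hφ₀i)]
    exact integral_congr_ae (Eventually.of_forall fun x => by simp only [Pi.add_apply, inner_add_right])
  have rhs : ∫ x, ⟪u s x, heatTest ν (φ + φ₀) (t - s) x⟫ =
      (∫ x, ⟪u s x, heatTest ν φ (t - s) x⟫) + ∫ x, ⟪u s x, heatTest ν φ₀ (t - s) x⟫ := by
    have hh : ∀ x, heatTest ν (φ + φ₀) (t - s) x = heatTest ν φ (t - s) x + heatTest ν φ₀ (t - s) x :=
      fun x => heatFlow_add_of_bound hφ.contDiff.continuous hφ₀.contDiff.continuous hC hC₀ _ x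
    have i1 : Integrable (fun x => ⟪u s x, heatTest ν φ (t - s) x⟫) :=
      integrable_inner_of_aestronglyMeasurable_of_norm_le (hmeas s hs) (hM s hs)
        (integrable_heatFlow hφi (ν * (t - s)))
    have i2 : Integrable (fun x => ⟪u s x, heatTest ν φ₀ (t - s) x⟫) :=
      integrable_inner_of_aestronglyMeasurable_of_norm_le (hmeas s hs) (hM s hs)
        (integrable_heatFlow hφ₀i (ν * (t - s)))
    rw [← integral_add i1 i2]
    exact integral_congr_ae (Eventually.of_forall fun x => by simp only [hh x, inner_add_right])
  rw [lhs, rhs, e0] at e1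
  exact add_right_cancel e1

/-- The degenerate identity persists for every earlier initial time `s' ≤ s` (a non-integrable
integrand on `(s, t)` is non-integrable on `(s', t) ⊇ (s, t)`). [folklore] -/
theorem IsBoundedAncientMildSolution.integral_inner_eq_heatTest_of_not_intervalIntegrable_of_le
    (hu : IsBoundedAncientMildSolution ν u) (hM : ∀ t < 0, ∀ x, ‖u t x‖ ≤ M)
    (hmeas : ∀ t < 0, AEStronglyMeasurable (u t) volume) {s t : ℝ} (hst : s < t) (ht : t < 0)
    {φ₀ : E → E} (hφ₀ : FunctionSpaces.IsTestFunctionOn (⊤ : Opens E) φ₀) (hdiv₀ : VectorCalculus.IsDivFree φ₀)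
    (hbad : ¬ IntervalIntegrable (fun τ => ∫ x, ⟪u τ x, convect (u τ) (heatTest ν φ₀ (t - τ)) x⟫) volume s t)
    {φ : E → E} (hφ : FunctionSpaces.IsTestFunctionOn (⊤ : Opens E) φ) (hdiv : VectorCalculus.IsDivFree φ)
    {s' : ℝ} (hs' : s' ≤ s) :
    ∫ x, ⟪u t x, φ x⟫ = ∫ x, ⟪u s' x, heatTest ν φ (t - s') x⟫ := by
  refine hu.integral_inner_eq_heatTest_of_not_intervalIntegrable hM hmeas (hs'.trans_lt hst) ht hφ₀ hdiv₀
    (fun h => hbad (h.mono_set ?_)) hφ hdiv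
  rw [uIcc_of_le hst.le, uIcc_of_le (hs'.trans hst.le)]
  exact Icc_subset_Icc hs' le_rfl

/-- **Caloric decay of a divergence-free test field in `L¹`**: `∫‖e^{νσΔ}φ‖ ≤ K σ^{-1/2}` for
`σ > 0`. A divergence-free field is a sum of directional derivatives of test fields,
`φ = Σᵢ ∂_{bᵢ} Ξᵢ` with `Ξᵢ(x) = ⟪bᵢ, φ(x)⟫ x` in an orthonormal frame `b` (indeed
`Σᵢ ∂_{bᵢ}Ξᵢ = (div φ) x + φ = φ`), and each `e^{σΔ}∂_{bᵢ}Ξᵢ` decays in `L¹` like `σ^{-1/2}`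
(`exists_integral_norm_heatExtension_fderiv_apply_le`). [folklore] -/
theorem exists_integral_norm_heatTest_le_of_isDivFree {φ : E → E}
    (hφ : FunctionSpaces.IsTestFunctionOn (⊤ : Opens E) φ) (hdiv : VectorCalculus.IsDivFree φ)
    {ν : ℝ} (hν : 0 < ν) :
    ∃ K : ℝ, 0 ≤ K ∧ ∀ σ : ℝ, 0 < σ → ∫ x, ‖heatTest ν φ σ x‖ ≤ K * σ ^ (-(1 / 2 : ℝ)) := by
  set b := stdOrthonormalBasis ℝ E
  set Ξ : Fin (Module.finrank ℝ E) → E → E := fun i z => ⟪b i, φ z⟫ • z with hΞ_def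
  have hφd : Differentiable ℝ φ := hφ.contDiff.differentiable (by simp)
  have hΞt : ∀ i, FunctionSpaces.IsTestFunctionOn (⊤ : Opens E) (Ξ i) := fun i =>
    { contDiff := (contDiff_const.inner ℝ hφ.contDiff).smul contDiff_id
      hasCompactSupport := hφ.hasCompactSupport.mono fun z hz => by
        rw [mem_support] at hz ⊢
        intro h0
        exact hz (by simp [hΞ_def, h0])
      tsupport_subset := by simp }
  -- `φ = Σᵢ ∂_{bᵢ} Ξᵢ`
  have hrep : ∀ z, φ z = ∑ i, fderiv ℝ (Ξ i) z (b i) := by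
    intro z
    have hDΞ : ∀ i, fderiv ℝ (Ξ i) z (b i) = ⟪b i, φ z⟫ • b i + ⟪b i, fderiv ℝ φ z (b i)⟫ • z := by
      intro i
      have hc : HasFDerivAt (fun y => ⟪b i, φ y⟫) ((innerSL ℝ (b i)).comp (fderiv ℝ φ z)) z :=
        (innerSL ℝ (b i)).hasFDerivAt.comp z (hφd z).hasFDerivAt
      have h : HasFDerivAt (Ξ i) (⟪b i, φ z⟫ • ContinuousLinearMap.id ℝ E +
          ((innerSL ℝ (b i)).comp (fderiv ℝ φ z)).smulRight z) z := hc.smul (hasFDerivAt_id z)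
      rw [h.fderiv]
      simp
    have hsum : ∑ i, ⟪b i, fderiv ℝ φ z (b i)⟫ = 0 := by
      rw [← divergence_eq_sum_inner_fderiv b φ z]
      exact hdiv z
    calc φ z = ∑ i, ⟪b i, φ z⟫ • b i := (b.sum_repr' (φ z)).symm
      _ = ∑ i, ⟪b i, φ z⟫ • b i + (∑ i, ⟪b i, fderiv ℝ φ z (b i)⟫) • z := by
          rw [hsum, zero_smul, add_zero]
      _ = ∑ i, fderiv ℝ (Ξ i) z (b i) := by
          rw [Finset.sum_smul, ← Finset.sum_add_distrib]
          exact Finset.sum_congr rfl fun i _ => (hDΞ i).symm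
  -- the caloric decay of each summand
  have hK : ∀ i, ∃ K : ℝ, ∀ σ : ℝ, 0 < σ →
      ∫ x, ‖UnboundedOperators.heatExtension (fun z => fderiv ℝ (Ξ i) z (b i)) σ x‖ ≤ K * σ ^ (-(1 / 2 : ℝ)) :=
    fun i => exists_integral_norm_heatExtension_fderiv_apply_le (hΞt i) (b i)
  choose K hK using hK
  have hg : ∀ i, Continuous (fun z => fderiv ℝ (Ξ i) z (b i)) ∧
      HasCompactSupport (fun z => fderiv ℝ (Ξ i) z (b i)) := fun i =>
    ⟨((hΞt i).contDiff.continuous_fderiv (by simp)).clm_apply continuous_const,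
      (hΞt i).hasCompactSupport.fderiv_apply (𝕜 := ℝ) (b i)⟩
  refine ⟨(∑ i, max (K i) 0) * ν ^ (-(1 / 2 : ℝ)), by positivity, fun σ hσ => ?_⟩
  have hνσ : 0 < ν * σ := mul_pos hν hσ
  have hdecomp : ∀ x, heatTest ν φ σ x =
      ∑ i, UnboundedOperators.heatExtension (fun z => fderiv ℝ (Ξ i) z (b i)) (ν * σ) x := by
    intro x
    rw [show heatTest ν φ σ = heatFlow φ (ν * σ) from rfl, heatFlow_of_pos _ hνσ,
      show φ = fun z => ∑ i, fderiv ℝ (Ξ i) z (b i) from funext hrep]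
    exact UnboundedOperators.heatExtension_finset_sum _ _ _ fun i _ =>
      UnboundedOperators.integrable_heatKernel_smul_comp_sub (hg i).1 (hg i).2 _ x
  have hint : ∀ i, Integrable
      (UnboundedOperators.heatExtension (fun z => fderiv ℝ (Ξ i) z (b i)) (ν * σ)) := fun i =>
    UnboundedOperators.integrable_heatExtension ((hg i).1.integrable_of_hasCompactSupport (hg i).2) hνσ
  set H : Fin (Module.finrank ℝ E) → E → E := fun i =>
    UnboundedOperators.heatExtension (fun z => fderiv ℝ (Ξ i) z (b i)) (ν * σ) with hH_def
  calc ∫ x, ‖heatTest ν φ σ x‖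
      = ∫ x, ‖∑ i, H i x‖ := integral_congr_ae (Eventually.of_forall fun x => by simp only [hdecomp x, hH_def])
    _ ≤ ∫ x, ∑ i, ‖H i x‖ :=
        integral_mono (integrable_finsetSum Finset.univ fun i _ => hint i).norm
          (integrable_finsetSum Finset.univ fun i _ => (hint i).norm) fun x => norm_sum_le _ _
    _ = ∑ i, ∫ x, ‖H i x‖ := integral_finsetSum Finset.univ fun i _ => (hint i).norm
    _ ≤ ∑ i, max (K i) 0 * (ν * σ) ^ (-(1 / 2 : ℝ)) :=
        Finset.sum_le_sum fun i _ => (hK i _ hνσ).trans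
          (mul_le_mul_of_nonneg_right (le_max_left _ _) (Real.rpow_nonneg hνσ.le _))
    _ = (∑ i, max (K i) 0) * ν ^ (-(1 / 2 : ℝ)) * σ ^ (-(1 / 2 : ℝ)) := by
        rw [← Finset.sum_mul, Real.mul_rpow hν.le hσ.le]
        ring

/-- **In the heat regime all solenoidal pairings of the final slice vanish.** Under the
hypotheses of `integral_inner_eq_heatTest_of_not_intervalIntegrable` (and `0 < ν`), for every
divergence-free test field `φ`: `∫⟪u t, φ⟫ = ∫⟪u s', e^{ν(t−s')Δ}φ⟫` for all `s' ≤ s`, and the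
right-hand side is at most `M K (t − s')^{-1/2} → 0` as `s' → −∞`
(`exists_integral_norm_heatTest_le_of_isDivFree`). [folklore] -/
theorem IsBoundedAncientMildSolution.integral_inner_eq_zero_of_not_intervalIntegrable
    (hu : IsBoundedAncientMildSolution ν u) (hν : 0 < ν) (hM : ∀ t < 0, ∀ x, ‖u t x‖ ≤ M)
    (hmeas : ∀ t < 0, AEStronglyMeasurable (u t) volume) {s t : ℝ} (hst : s < t) (ht : t < 0)
    {φ₀ : E → E} (hφ₀ : FunctionSpaces.IsTestFunctionOn (⊤ : Opens E) φ₀) (hdiv₀ : VectorCalculus.IsDivFree φ₀)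
    (hbad : ¬ IntervalIntegrable (fun τ => ∫ x, ⟪u τ x, convect (u τ) (heatTest ν φ₀ (t - τ)) x⟫) volume s t)
    {φ : E → E} (hφ : FunctionSpaces.IsTestFunctionOn (⊤ : Opens E) φ) (hdiv : VectorCalculus.IsDivFree φ) :
    ∫ x, ⟪u t x, φ x⟫ = 0 := by
  obtain ⟨K, hK0, hK⟩ := exists_integral_norm_heatTest_le_of_isDivFree hφ hdiv hν
  have hM0 : 0 ≤ M := (norm_nonneg _).trans (hM t ht 0)
  have hφi : Integrable φ := hφ.contDiff.continuous.integrable_of_hasCompactSupport hφ.hasCompactSupport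
  set a := ∫ x, ⟪u t x, φ x⟫ with ha
  have hbound : ∀ s' ≤ s, ‖a‖ ≤ M * K * (t - s') ^ (-(1 / 2 : ℝ)) := by
    intro s' hs'
    have hs'0 : s' < 0 := hs'.trans_lt (hst.trans ht)
    have hts' : 0 < t - s' := by linarith
    rw [ha, hu.integral_inner_eq_heatTest_of_not_intervalIntegrable_of_le hM hmeas hst ht hφ₀ hdiv₀ hbad
      hφ hdiv hs']
    have hψi : Integrable (heatTest ν φ (t - s')) := integrable_heatFlow hφi _
    calc ‖∫ x, ⟪u s' x, heatTest ν φ (t - s') x⟫‖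
        ≤ ∫ x, M * ‖heatTest ν φ (t - s') x‖ :=
          norm_integral_le_of_norm_le (hψi.norm.const_mul M) (Eventually.of_forall fun x =>
            (norm_inner_le_norm _ _).trans (mul_le_mul_of_nonneg_right (hM s' hs'0 x) (norm_nonneg _)))
      _ = M * ∫ x, ‖heatTest ν φ (t - s') x‖ := integral_const_mul _ _
      _ ≤ M * (K * (t - s') ^ (-(1 / 2 : ℝ))) := mul_le_mul_of_nonneg_left (hK _ hts') hM0
      _ = M * K * (t - s') ^ (-(1 / 2 : ℝ)) := by ring
  have htend : Tendsto (fun s' : ℝ => M * K * (t - s') ^ (-(1 / 2 : ℝ))) atBot (𝓝 0) := by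
    have h1 : Tendsto (fun s' : ℝ => t - s') atBot atTop := by
      simpa only [sub_eq_add_neg] using tendsto_atTop_add_const_left atBot t tendsto_neg_atBot_atTop
    have h2 := (tendsto_rpow_neg_atTop (by norm_num : (0 : ℝ) < 1 / 2)).comp h1
    simpa using h2.const_mul (M * K)
  have hle : ‖a‖ ≤ 0 :=
    ge_of_tendsto htend (by filter_upwards [eventually_le_atBot s] with s' hs' using hbound s' hs')
  exact norm_le_zero_iff.1 hle

/-- **A non-integrable nonlinear term forces a constant slice.** Let `u` be a bounded ancient
mild solution (`0 < ν`) with measurable slices and `s < t < 0`. If for some divergence-free test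
field the nonlinear time integrand of the identity between `s` and `t` is not integrable, then
the slice `u t` is a.e. equal to a constant (all its solenoidal pairings vanish,
`integral_inner_eq_zero_of_not_intervalIntegrable`, and a bounded weakly divergence-free field
annihilating the solenoidal tests is a.e. constant — KNSS's Liouville step for `curl = 0`,
`div = 0`, `IsWeaklyDivFree.exists_ae_eq_const_of_norm_le_of_forall_integral_inner_eq_zero`). The
constant is the drift `b(t)` of KNSS 2009, §1. [cite: KochNadirashviliSereginSverak2009, §1 p. 3 and Lemma 3.1 (arXiv p. 7)] -/
theorem IsBoundedAncientMildSolution.exists_ae_eq_const_of_not_intervalIntegrable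
    (hu : IsBoundedAncientMildSolution ν u) (hν : 0 < ν)
    (hmeas : ∀ t < 0, AEStronglyMeasurable (u t) volume) {s t : ℝ} (hst : s < t) (ht : t < 0)
    {φ₀ : E → E} (hφ₀ : FunctionSpaces.IsTestFunctionOn (⊤ : Opens E) φ₀) (hdiv₀ : VectorCalculus.IsDivFree φ₀)
    (hbad : ¬ IntervalIntegrable (fun τ => ∫ x, ⟪u τ x, convect (u τ) (heatTest ν φ₀ (t - τ)) x⟫) volume s t) :
    ∃ c : E, u t =ᵐ[volume] fun _ => c := by
  obtain ⟨M, hM'⟩ := hu.2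
  have hM : ∀ t < 0, ∀ x, ‖u t x‖ ≤ M := fun t ht x => hM' t ht x
  exact IsWeaklyDivFree.exists_ae_eq_const_of_norm_le_of_forall_integral_inner_eq_zero (hmeas t ht)
    (hM t ht) (hu.1.1 t ht) fun φ hφ hdiv =>
      hu.integral_inner_eq_zero_of_not_intervalIntegrable hν hM hmeas hst ht hφ₀ hdiv₀ hbad hφ hdiv

/-- **At a slice which is not a.e. constant, every nonlinear time integrand ending there is
honestly integrable** (contrapositive of `exists_ae_eq_const_of_not_intervalIntegrable`): the
junk value of the time integral never enters the identities ending at such a time. [folklore] -/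
theorem IsBoundedAncientMildSolution.intervalIntegrable_nonlinear_of_not_ae_const
    (hu : IsBoundedAncientMildSolution ν u) (hν : 0 < ν)
    (hmeas : ∀ t < 0, AEStronglyMeasurable (u t) volume) {t : ℝ} (ht : t < 0)
    (hnc : ∀ c : E, ¬ (u t =ᵐ[volume] fun _ => c)) {s : ℝ} (hst : s < t)
    {φ : E → E} (hφ : FunctionSpaces.IsTestFunctionOn (⊤ : Opens E) φ) (hdiv : VectorCalculus.IsDivFree φ) :
    IntervalIntegrable (fun τ => ∫ x, ⟪u τ x, convect (u τ) (heatTest ν φ (t - τ)) x⟫) volume s t := by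
  by_contra hbad
  obtain ⟨c, hc⟩ := hu.exists_ae_eq_const_of_not_intervalIntegrable hν hmeas hst ht hφ hdiv hbad
  exact hnc c hc

end HeatRegime


/-! ### Invariant slices: pairings with translates and with directional derivatives -/

section Invariant

variable {F : Type*} [NormedAddCommGroup F] [NormedSpace ℝ F]

/-- If a field `v` is a.e. invariant under the translations along `e`, its pairing with any
field `g` is unchanged when `g` is translated along `e` (translation invariance of Lebesgue
measure). [folklore] -/
theorem integral_inner_comp_add_smul_of_ae_invariant {v : E → E} {e : E}
    (hinv : ∀ h : ℝ, (fun x => v (x + h • e)) =ᵐ[volume] v) (g : E → E) (h : ℝ) :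
    ∫ x, ⟪v x, g (x + h • e)⟫ = ∫ x, ⟪v x, g x⟫ := by
  have h1 : ∫ x, ⟪v (x - h • e), g x⟫ = ∫ x, ⟪v x, g (x + h • e)⟫ := by
    have := integral_sub_right_eq_self (μ := volume) (fun x => ⟪v x, g (x + h • e)⟫) (h • e)
    simpa only [sub_add_cancel] using this
  rw [← h1]
  refine integral_congr_ae ?_
  filter_upwards [hinv (-h)] with x hx
  rw [neg_smul, ← sub_eq_add_neg] at hx
  rw [hx]

/-- Off a fixed compact set, a compactly supported `C¹` field, its unit translates along `e` and
its derivative all vanish. [folklore] -/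
theorem exists_isCompact_eq_zero_of_hasCompactSupport {φ : E → F} (hc : HasCompactSupport φ) (e : E) :
    ∃ K : Set E, IsCompact K ∧ MeasurableSet K ∧ ∀ {h : ℝ}, |h| ≤ 1 → ∀ x ∉ K,
      φ x = 0 ∧ φ (x + h • e) = 0 ∧ fderiv ℝ φ x = 0 := by
  obtain ⟨R, hR⟩ := hc.isCompact.isBounded.subset_closedBall (0 : E)
  refine ⟨Metric.closedBall (0 : E) (max R 0 + ‖e‖), isCompact_closedBall _ _,
    Metric.isClosed_closedBall.measurableSet, fun {h} hh x hx => ?_⟩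
  rw [Metric.mem_closedBall, dist_zero_right, not_le] at hx
  have hx' : x ∉ tsupport φ := fun h' => by
    have := hR h'
    rw [Metric.mem_closedBall, dist_zero_right] at this
    linarith [le_max_left R 0, norm_nonneg e]
  have hxe : x + h • e ∉ tsupport φ := fun h' => by
    have := hR h'
    rw [Metric.mem_closedBall, dist_zero_right] at this
    have h1 : ‖x‖ ≤ ‖x + h • e‖ + ‖h • e‖ := by
      simpa only [add_sub_cancel_right] using norm_sub_le (x + h • e) (h • e)
    have h2 : ‖h • e‖ ≤ ‖e‖ := by
      rw [norm_smul, Real.norm_eq_abs]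
      exact mul_le_of_le_one_left (norm_nonneg _) hh
    linarith [le_max_left R 0]
  exact ⟨image_eq_zero_of_notMem_tsupport hx', image_eq_zero_of_notMem_tsupport hxe,
    image_eq_zero_of_notMem_tsupport fun h' => hx' (tsupport_fderiv_subset ℝ h')⟩

/-- **Difference quotients of a compactly supported `C¹` field converge in `L¹` to the directional
derivative**: `∫ ‖h⁻¹(φ(x + he) − φ(x)) − ∂ₑφ(x)‖ dx → 0` as `h → 0` (dominated convergence: the
integrands converge pointwise, are supported in a fixed compact set for `|h| ≤ 1` and are bounded
by the Lipschitz constant of `φ`). [folklore] -/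
theorem tendsto_integral_norm_slope_sub_fderiv {φ : E → F} (hφ : ContDiff ℝ 1 φ)
    (hc : HasCompactSupport φ) (e : E) :
    Tendsto (fun h : ℝ => ∫ x, ‖h⁻¹ • (φ (x + h • e) - φ x) - fderiv ℝ φ x e‖) (𝓝[≠] 0) (𝓝 0) := by
  obtain ⟨L, hL⟩ := ContDiff.lipschitzWith_of_hasCompactSupport hc hφ one_ne_zero
  obtain ⟨C', hC'⟩ := (hc.fderiv ℝ).exists_bound_of_continuous (hφ.continuous_fderiv one_ne_zero)
  obtain ⟨K, hK, hKm, hvan⟩ := exists_isCompact_eq_zero_of_hasCompactSupport hc e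
  have hφc : Continuous φ := hφ.continuous
  have hDc : Continuous fun x => fderiv ℝ φ x e := (hφ.continuous_fderiv one_ne_zero).clm_apply continuous_const
  set G : ℝ → E → ℝ := fun h x => ‖h⁻¹ • (φ (x + h • e) - φ x) - fderiv ℝ φ x e‖ with hG
  have hmeasG : ∀ h, AEStronglyMeasurable (G h) volume := fun h =>
    (((continuous_const.smul ((hφc.comp (continuous_id.add continuous_const)).sub hφc)).sub
      hDc).norm).aestronglyMeasurable
  -- domination on `0 < |h| ≤ 1`
  have hmem : {h : ℝ | |h| ≤ 1} ∈ 𝓝[≠] (0 : ℝ) := by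
    refine mem_nhdsWithin_of_mem_nhds ?_
    have : Metric.closedBall (0 : ℝ) 1 ∈ 𝓝 (0 : ℝ) := Metric.closedBall_mem_nhds 0 one_pos
    refine Filter.mem_of_superset this fun h hh => ?_
    simpa [Real.dist_eq] using hh
  have hbound : ∀ᶠ h in 𝓝[≠] (0 : ℝ), ∀ᵐ x ∂(volume : Measure E),
      ‖G h x‖ ≤ K.indicator (fun _ => (L : ℝ) * ‖e‖ + C' * ‖e‖) x := by
    filter_upwards [hmem, self_mem_nhdsWithin] with h hh hh0
    refine Eventually.of_forall fun x => ?_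
    rw [hG, Real.norm_eq_abs, abs_of_nonneg (norm_nonneg _)]
    by_cases hx : x ∈ K
    · rw [indicator_of_mem hx]
      refine (norm_sub_le _ _).trans (add_le_add ?_ ?_)
      · rw [norm_smul, norm_inv, Real.norm_eq_abs]
        have hdist := hL.dist_le_mul (x + h • e) x
        rw [dist_eq_norm, dist_eq_norm, add_sub_cancel_left, norm_smul, Real.norm_eq_abs] at hdist
        have hh0' : 0 < |h| := abs_pos.2 hh0
        calc |h|⁻¹ * ‖φ (x + h • e) - φ x‖ ≤ |h|⁻¹ * (L * (|h| * ‖e‖)) :=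
              mul_le_mul_of_nonneg_left hdist (inv_nonneg.2 hh0'.le)
          _ = L * ‖e‖ := by field_simp
      · exact (ContinuousLinearMap.le_opNorm _ _).trans
          (mul_le_mul_of_nonneg_right (hC' x) (norm_nonneg _))
    · obtain ⟨h1, h2, h3⟩ := hvan hh x hx
      rw [indicator_of_notMem hx, h1, h2, h3]
      simp
  have hint : Integrable (K.indicator fun _ => (L : ℝ) * ‖e‖ + C' * ‖e‖) volume :=
    (integrable_indicator_iff hKm).2 (integrableOn_const (hK.measure_lt_top).ne)
  -- pointwise convergence
  have hlim : ∀ᵐ x ∂(volume : Measure E), Tendsto (fun h => G h x) (𝓝[≠] 0) (𝓝 0) := by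
    refine Eventually.of_forall fun x => ?_
    have hp : HasDerivAt (fun s : ℝ => x + s • e) e 0 := by
      simpa using ((hasDerivAt_id (0 : ℝ)).smul_const e).const_add x
    have hd : HasDerivAt (fun s : ℝ => φ (x + s • e)) (fderiv ℝ φ x e) 0 := by
      have := (hφ.differentiable one_ne_zero (x + (0 : ℝ) • e)).hasFDerivAt.comp_hasDerivAt (0 : ℝ) hp
      simpa [Function.comp_def] using this
    have ht := hd.tendsto_slope_zero
    simp only [zero_add, zero_smul, add_zero] at ht
    have := (ht.sub_const (fderiv ℝ φ x e)).norm
    rw [sub_self, norm_zero] at this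
    exact this
  have := tendsto_integral_filter_of_dominated_convergence (f := fun _ => (0 : ℝ))
    (K.indicator fun _ => (L : ℝ) * ‖e‖ + C' * ‖e‖) (Eventually.of_forall hmeasG) hbound hint hlim
  simpa using this

/-- **The slices invariant along `e` annihilate the `e`-derivatives of the caloric test fields**:
if `v` is bounded, measurable and `v(· + he) = v` a.e. for every `h`, then
`∫⟪v, ∂ₑ e^{νσΔ}φ⟫ = 0` for every test field `φ` and all `ν`, `σ`. Proof: `∂ₑe^{νσΔ}φ =
e^{νσΔ}∂ₑφ` is the `L¹`-limit of the heat flows of the difference quotients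
`h⁻¹(φ(· + he) − φ)` (`tendsto_integral_norm_slope_sub_fderiv`, the heat flow contracts `L¹`),
and those pair to `h⁻¹(∫⟪v, (e^{νσΔ}φ)(· + he)⟫ − ∫⟪v, e^{νσΔ}φ⟫) = 0` (the heat flow commutes
with translations, `integral_inner_comp_add_smul_of_ae_invariant`). [folklore] -/
theorem integral_inner_fderiv_heatTest_apply_eq_zero_of_ae_invariant {v : E → E}
    (hv : AEStronglyMeasurable v volume) {M : ℝ} (hM : ∀ x, ‖v x‖ ≤ M) {e : E}
    (hinv : ∀ h : ℝ, (fun x => v (x + h • e)) =ᵐ[volume] v)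
    {φ : E → E} (hφ : FunctionSpaces.IsTestFunctionOn (⊤ : Opens E) φ) (ν σ : ℝ) :
    ∫ x, ⟪v x, fderiv ℝ (heatTest ν φ σ) x e⟫ = 0 := by
  set σ' := ν * σ with hσ'
  have hM0 : 0 ≤ M := (norm_nonneg _).trans (hM 0)
  have hφ1 : ContDiff ℝ 1 φ := hφ.contDiff.of_le (by exact_mod_cast le_top)
  have hφc : Continuous φ := hφ.contDiff.continuous
  have hφi : Integrable φ := hφc.integrable_of_hasCompactSupport hφ.hasCompactSupport
  obtain ⟨C, hC⟩ := hφ.exists_norm_le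
  have hDe_c : Continuous fun z => fderiv ℝ φ z e := (hφ1.continuous_fderiv one_ne_zero).clm_apply continuous_const
  have hDe_supp : HasCompactSupport fun z => fderiv ℝ φ z e := hφ.hasCompactSupport.fderiv_apply (𝕜 := ℝ) e
  have hDe_i : Integrable fun z => fderiv ℝ φ z e := hDe_c.integrable_of_hasCompactSupport hDe_supp
  obtain ⟨C', hC'⟩ := hDe_c.bounded_above_of_compact_support hDe_supp
  -- `∂ₑ e^{σ'Δ}φ = e^{σ'Δ} ∂ₑφ`
  have hD : ∀ x, fderiv ℝ (heatTest ν φ σ) x e = heatFlow (fun z => fderiv ℝ φ z e) σ' x := fun x =>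
    fderiv_heatFlow_apply hφ1 hφ.hasCompactSupport σ' x e
  -- the difference quotients
  set q : ℝ → E → E := fun h z => h⁻¹ • (φ (z + h • e) - φ z) with hq
  have hq_cont : ∀ h, Continuous (q h) := fun h =>
    continuous_const.smul ((hφc.comp (continuous_id.add continuous_const)).sub hφc)
  have hq_bound : ∀ h z, ‖q h z‖ ≤ |h|⁻¹ * (C + C) := fun h z => by
    rw [hq]
    dsimp only
    rw [norm_smul, norm_inv, Real.norm_eq_abs]
    exact mul_le_mul_of_nonneg_left ((norm_sub_le _ _).trans (add_le_add (hC _) (hC _)))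
      (inv_nonneg.2 (abs_nonneg h))
  have hq_int : ∀ h, Integrable (q h) := fun h => ((hφi.comp_add_right (h • e)).sub hφi).smul h⁻¹
  -- their heat flows pair to zero with `v`
  have hzero : ∀ h, ∫ x, ⟪v x, heatFlow (q h) σ' x⟫ = 0 := by
    intro h
    have hshift_c : Continuous fun z => φ (z + h • e) := hφc.comp (continuous_id.add continuous_const)
    have hflow : ∀ x, heatFlow (q h) σ' x = h⁻¹ • (heatFlow φ σ' (x + h • e) - heatFlow φ σ' x) := by
      intro x
      rw [hq]
      dsimp only
      rw [heatFlow_const_smul, heatFlow_sub_of_bound hshift_c hφc (fun z => hC _) hC,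
        heatFlow_comp_add_right_apply]
    have hψi : Integrable (heatFlow φ σ') := integrable_heatFlow hφi σ'
    have i1 : Integrable fun x => ⟪v x, heatFlow φ σ' (x + h • e)⟫ :=
      integrable_inner_of_aestronglyMeasurable_of_norm_le hv hM (hψi.comp_add_right (h • e))
    have i2 : Integrable fun x => ⟪v x, heatFlow φ σ' x⟫ :=
      integrable_inner_of_aestronglyMeasurable_of_norm_le hv hM hψi
    calc ∫ x, ⟪v x, heatFlow (q h) σ' x⟫
        = ∫ x, h⁻¹ * (⟪v x, heatFlow φ σ' (x + h • e)⟫ - ⟪v x, heatFlow φ σ' x⟫) :=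
          integral_congr_ae (Eventually.of_forall fun x => by
            simp only [hflow x, real_inner_smul_right, inner_sub_right])
      _ = h⁻¹ * ((∫ x, ⟪v x, heatFlow φ σ' (x + h • e)⟫) - ∫ x, ⟪v x, heatFlow φ σ' x⟫) := by
          rw [integral_const_mul, integral_sub i1 i2]
      _ = 0 := by rw [integral_inner_comp_add_smul_of_ae_invariant hinv, sub_self, mul_zero]
  -- the error is controlled by the `L¹` distance of the difference quotient to `∂ₑφ`
  have hest : ∀ h : ℝ, ‖∫ x, ⟪v x, fderiv ℝ (heatTest ν φ σ) x e⟫‖ ≤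
      M * ∫ x, ‖h⁻¹ • (φ (x + h • e) - φ x) - fderiv ℝ φ x e‖ := by
    intro h
    have hr_c : Continuous fun z => q h z - fderiv ℝ φ z e := (hq_cont h).sub hDe_c
    have hr_b : ∀ z, ‖q h z - fderiv ℝ φ z e‖ ≤ |h|⁻¹ * (C + C) + C' := fun z =>
      (norm_sub_le _ _).trans (add_le_add (hq_bound h z) (hC' z))
    have hr_i : Integrable fun z => q h z - fderiv ℝ φ z e := (hq_int h).sub hDe_i
    have hdiff : ∀ x, fderiv ℝ (heatTest ν φ σ) x e =
        heatFlow (q h) σ' x - heatFlow (fun z => q h z - fderiv ℝ φ z e) σ' x := by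
      intro x
      rw [hD x, heatFlow_sub_of_bound (hq_cont h) hDe_c (hq_bound h) hC', sub_sub_cancel]
    have i3 : Integrable fun x => ⟪v x, heatFlow (q h) σ' x⟫ :=
      integrable_inner_of_aestronglyMeasurable_of_norm_le hv hM (integrable_heatFlow (hq_int h) σ')
    have i4 : Integrable fun x => ⟪v x, heatFlow (fun z => q h z - fderiv ℝ φ z e) σ' x⟫ :=
      integrable_inner_of_aestronglyMeasurable_of_norm_le hv hM (integrable_heatFlow hr_i σ')
    calc ‖∫ x, ⟪v x, fderiv ℝ (heatTest ν φ σ) x e⟫‖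
        = ‖(∫ x, ⟪v x, heatFlow (q h) σ' x⟫) -
            ∫ x, ⟪v x, heatFlow (fun z => q h z - fderiv ℝ φ z e) σ' x⟫‖ := by
          rw [← integral_sub i3 i4]
          congr 1
          exact integral_congr_ae (Eventually.of_forall fun x => by
            simp only [hdiff x, inner_sub_right])
      _ = ‖∫ x, ⟪v x, heatFlow (fun z => q h z - fderiv ℝ φ z e) σ' x⟫‖ := by
          rw [hzero h, zero_sub, norm_neg]
      _ ≤ ∫ x, M * ‖heatFlow (fun z => q h z - fderiv ℝ φ z e) σ' x‖ :=
          norm_integral_le_of_norm_le ((integrable_heatFlow hr_i σ').norm.const_mul M)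
            (Eventually.of_forall fun x => (norm_inner_le_norm _ _).trans
              (mul_le_mul_of_nonneg_right (hM x) (norm_nonneg _)))
      _ = M * ∫ x, ‖heatFlow (fun z => q h z - fderiv ℝ φ z e) σ' x‖ := integral_const_mul _ _
      _ ≤ M * ∫ x, ‖q h x - fderiv ℝ φ x e‖ :=
          mul_le_mul_of_nonneg_left (integral_norm_heatFlow_le hr_i σ') hM0
      _ = M * ∫ x, ‖h⁻¹ • (φ (x + h • e) - φ x) - fderiv ℝ φ x e‖ := by rw [hq]
  have h0 : Tendsto (fun h : ℝ => M * ∫ x, ‖h⁻¹ • (φ (x + h • e) - φ x) - fderiv ℝ φ x e‖)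
      (𝓝[≠] 0) (𝓝 0) := by
    simpa using (tendsto_integral_norm_slope_sub_fderiv hφ1 hφ.hasCompactSupport e).const_mul M
  have hle : ‖∫ x, ⟪v x, fderiv ℝ (heatTest ν φ σ) x e⟫‖ ≤ 0 :=
    ge_of_tendsto h0 (Eventually.of_forall hest)
  exact norm_le_zero_iff.1 hle

/-- **A weakly divergence-free bounded slice annihilates the gradients of the components of the
caloric test fields**: `∫⟪c, D(e^{νσΔ}φ)(x)[v x]⟫ dx = ∫ D⟪c, e^{νσΔ}φ⟫(x)[v x] dx = 0` (the
weak divergence-free condition beyond compactly supported tests,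
`IsWeaklyDivFree.integral_fderiv_apply_eq_zero`, applicable since `e^{νσΔ}φ` and its derivative
are integrable). [folklore] -/
theorem IsWeaklyDivFree.integral_inner_const_fderiv_heatTest_apply_eq_zero {v : E → E}
    (hdiv : IsWeaklyDivFree v) (hv : AEStronglyMeasurable v volume) {M : ℝ} (hM : ∀ x, ‖v x‖ ≤ M)
    (c : E) {φ : E → E} (hφ : FunctionSpaces.IsTestFunctionOn (⊤ : Opens E) φ) (ν σ : ℝ) :
    ∫ x, ⟪c, fderiv ℝ (heatTest ν φ σ) x (v x)⟫ = 0 := by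
  have hM0 : 0 ≤ M := (norm_nonneg _).trans (hM 0)
  have hφi : Integrable φ := hφ.contDiff.continuous.integrable_of_hasCompactSupport hφ.hasCompactSupport
  have hψ : ContDiff ℝ ∞ (heatTest ν φ σ) := contDiff_heatFlow hφ.contDiff hφ.hasCompactSupport _
  have hψi : Integrable (heatTest ν φ σ) := integrable_heatFlow hφi _
  set θ : E → ℝ := fun x => innerSL ℝ c (heatTest ν φ σ x) with hθ_def
  have hθ : ContDiff ℝ ∞ θ := (innerSL ℝ c).contDiff.comp hψ
  have hDθ : ∀ x w, fderiv ℝ θ x w = ⟪c, fderiv ℝ (heatTest ν φ σ) x w⟫ := fun x w => by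
    have h : HasFDerivAt θ ((innerSL ℝ c).comp (fderiv ℝ (heatTest ν φ σ) x)) x :=
      (innerSL ℝ c).hasFDerivAt.comp x (hψ.differentiable (by simp) x).hasFDerivAt
    rw [h.fderiv]
    simp
  have h1 : Integrable (fun x => fderiv ℝ θ x (v x)) := by
    have : Integrable fun x => ⟪c, convect v (heatTest ν φ σ) x⟫ :=
      (integrable_convect_heatTest hv hM hφ ν σ).const_inner c
    refine this.congr (Eventually.of_forall fun x => ?_)
    simp only [convect_apply, hDθ]
  have h2 : Integrable (fun x => θ x • v x) := by
    refine Integrable.mono' ((hψi.norm.const_mul ‖c‖).mul_const M)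
      (hθ.continuous.aestronglyMeasurable.smul hv) (Eventually.of_forall fun x => ?_)
    rw [norm_smul]
    have hθx : ‖θ x‖ ≤ ‖c‖ * ‖heatTest ν φ σ x‖ := by
      simp only [hθ_def, innerSL_apply_apply]
      exact norm_inner_le_norm _ _
    exact mul_le_mul hθx (hM x) (norm_nonneg _) (mul_nonneg (norm_nonneg _) (norm_nonneg _))
  have key := hdiv.integral_fderiv_apply_eq_zero hv hθ h1 h2
  simpa only [hDθ] using key

/-- **The nonlinear integrand does not see an invariant drift.** Let `v` be bounded, measurable,
weakly divergence free and a.e. invariant under the translations along `e`. Then for every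
`a : ℝ` and every test field `φ`,
`∫⟪v + a e, ((v + a e)·∇) e^{νσΔ}φ⟫ = ∫⟪v, (v·∇) e^{νσΔ}φ⟫`: of the three cross terms,
`∫⟪v, ∂_{ae}ψ⟫ = 0` by invariance (`integral_inner_fderiv_heatTest_apply_eq_zero_of_ae_invariant`),
`∫⟪ae, (v·∇)ψ⟫ = 0` by weak divergence-freeness
(`IsWeaklyDivFree.integral_inner_const_fderiv_heatTest_apply_eq_zero`) and `∫⟪ae, ∂_{ae}ψ⟫ = 0`
(`integral_inner_const_fderiv_heatFlow_eq_zero`). [folklore] -/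
theorem integral_inner_convect_heatTest_add_const_eq {v : E → E}
    (hv : AEStronglyMeasurable v volume) {M : ℝ} (hM : ∀ x, ‖v x‖ ≤ M) (hdiv : IsWeaklyDivFree v)
    {e : E} (hinv : ∀ h : ℝ, (fun x => v (x + h • e)) =ᵐ[volume] v) (a : ℝ)
    {φ : E → E} (hφ : FunctionSpaces.IsTestFunctionOn (⊤ : Opens E) φ) (ν σ : ℝ) :
    ∫ x, ⟪v x + a • e, convect (fun y => v y + a • e) (heatTest ν φ σ) x⟫ =
      ∫ x, ⟪v x, convect v (heatTest ν φ σ) x⟫ := by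
  have hφ1 : ContDiff ℝ 1 φ := hφ.contDiff.of_le (by exact_mod_cast le_top)
  set ψ := heatTest ν φ σ with hψ_def
  have hDe_c : Continuous fun z => fderiv ℝ φ z e := (hφ1.continuous_fderiv one_ne_zero).clm_apply continuous_const
  have hDe_i : Integrable fun x => fderiv ℝ ψ x e := by
    have : Integrable (heatFlow (fun z => fderiv ℝ φ z e) (ν * σ)) :=
      integrable_heatFlow (hDe_c.integrable_of_hasCompactSupport (hφ.hasCompactSupport.fderiv_apply (𝕜 := ℝ) e)) _
    exact this.congr (Eventually.of_forall fun x => (fderiv_heatFlow_apply hφ1 hφ.hasCompactSupport _ x e).symm)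
  have iA : Integrable fun x => ⟪v x, fderiv ℝ ψ x (v x)⟫ := by
    simpa only [convect_apply] using integrable_inner_convect_heatTest hv hM hφ ν σ
  have iB : Integrable fun x => ⟪v x, a • fderiv ℝ ψ x e⟫ :=
    integrable_inner_of_aestronglyMeasurable_of_norm_le hv hM (hDe_i.smul a)
  have iC : Integrable fun x => ⟪a • e, fderiv ℝ ψ x (v x)⟫ := by
    simpa only [convect_apply] using (integrable_convect_heatTest hv hM hφ ν σ).const_inner (a • e)
  have iD : Integrable fun x => ⟪a • e, a • fderiv ℝ ψ x e⟫ := (hDe_i.smul a).const_inner (a • e)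
  have eB : ∫ x, ⟪v x, a • fderiv ℝ ψ x e⟫ = 0 := by
    simp_rw [real_inner_smul_right]
    rw [integral_const_mul, integral_inner_fderiv_heatTest_apply_eq_zero_of_ae_invariant hv hM hinv hφ ν σ,
      mul_zero]
  have eC : ∫ x, ⟪a • e, fderiv ℝ ψ x (v x)⟫ = 0 :=
    hdiv.integral_inner_const_fderiv_heatTest_apply_eq_zero hv hM (a • e) hφ ν σ
  have eD : ∫ x, ⟪a • e, a • fderiv ℝ ψ x e⟫ = 0 := by
    simp_rw [real_inner_smul_right]
    rw [integral_const_mul, hψ_def, show heatTest ν φ σ = heatFlow φ (ν * σ) from rfl,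
      integral_inner_const_fderiv_heatFlow_eq_zero hφ1 hφ.hasCompactSupport (ν * σ) (a • e) e, mul_zero]
  have iAC : Integrable fun x => ⟪v x, fderiv ℝ ψ x (v x)⟫ + ⟪a • e, fderiv ℝ ψ x (v x)⟫ := iA.add iC
  have iBD : Integrable fun x => ⟪v x, a • fderiv ℝ ψ x e⟫ + ⟪a • e, a • fderiv ℝ ψ x e⟫ := iB.add iD
  calc ∫ x, ⟪v x + a • e, convect (fun y => v y + a • e) ψ x⟫
      = ∫ x, (⟪v x, fderiv ℝ ψ x (v x)⟫ + ⟪a • e, fderiv ℝ ψ x (v x)⟫) +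
          (⟪v x, a • fderiv ℝ ψ x e⟫ + ⟪a • e, a • fderiv ℝ ψ x e⟫) :=
        integral_congr_ae (Eventually.of_forall fun x => by
          simp only [convect_apply, map_add, map_smul, inner_add_left, inner_add_right])
    _ = ((∫ x, ⟪v x, fderiv ℝ ψ x (v x)⟫) + ∫ x, ⟪a • e, fderiv ℝ ψ x (v x)⟫) +
          ((∫ x, ⟪v x, a • fderiv ℝ ψ x e⟫) + ∫ x, ⟪a • e, a • fderiv ℝ ψ x e⟫) := by
        rw [integral_add iAC iBD, integral_add iA iC, integral_add iB iD]
    _ = ∫ x, ⟪v x, fderiv ℝ ψ x (v x)⟫ := by rw [eB, eC, eD]; ring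
    _ = ∫ x, ⟪v x, convect v ψ x⟫ := by simp only [convect_apply]

end Invariant

/-! ### The drift lemma -/

section Drift

variable {ν : ℝ} {u : ℝ → E → E}

/-- **The drift lemma.** Let `u` be a bounded ancient mild solution with measurable slices, `e` a
fixed vector and `d : ℝ → ℝ` *any* bounded function (no measurability is assumed). Suppose that for
a.e. `τ < 0` either `d τ = 0` or the slice `u τ` is a.e. invariant under every translation along
`e`. Then `(t, x) ↦ u t x + d t • e` is again a bounded ancient mild solution: its slices are
weakly divergence free and bounded, the two pairings of the duality identity do not see the
spatially constant drift (divergence-free tests and their caloric extensions have zero mean), and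
its nonlinear time integrand coincides with that of `u` at a.e. `τ`
(`integral_inner_convect_heatTest_add_const_eq`), so that both time integrals — honest or junk —
agree. This is the duality-form shadow of the Galilean ambiguity `b(t)` of KNSS 2009, §1 p. 3.
[cite: KochNadirashviliSereginSverak2009, §1 p. 3 (parasitic solutions u(x,t) = b(t))] -/
theorem IsBoundedAncientMildSolution.add_timeConst_smul_of_ae_invariant
    (hu : IsBoundedAncientMildSolution ν u) (hmeas : ∀ t < 0, AEStronglyMeasurable (u t) volume)
    (e : E) {d : ℝ → ℝ} (hd : ∃ D : ℝ, ∀ t < 0, |d t| ≤ D)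
    (hinv : ∀ᵐ τ ∂((volume : Measure ℝ).restrict (Iio 0)),
      d τ = 0 ∨ ∀ h : ℝ, (fun x => u τ (x + h • e)) =ᵐ[volume] u τ) :
    IsBoundedAncientMildSolution ν (fun t x => u t x + d t • e) := by
  obtain ⟨M, hM'⟩ := hu.2
  have hM : ∀ t < 0, ∀ x, ‖u t x‖ ≤ M := fun t ht x => hM' t ht x
  obtain ⟨D, hD⟩ := hd
  refine ⟨⟨fun t ht θ hθ => ?_, fun s t hst ht φ hφ hdiv => ?_⟩, ⟨M + D * ‖e‖, fun t ht x => ?_⟩⟩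
  · -- weakly divergence free slices
    haveI : CompleteSpace E := FiniteDimensional.complete ℝ E
    have hθ1 : ContDiff ℝ 1 θ := hθ.contDiff.of_le (by exact_mod_cast le_top)
    have hgc : Continuous (gradient θ) :=
      (InnerProductSpace.toDual ℝ E).symm.continuous.comp (hθ1.continuous_fderiv one_ne_zero)
    have hgs : HasCompactSupport (gradient θ) :=
      (hθ.hasCompactSupport.fderiv ℝ).comp_left (g := fun L => (InnerProductSpace.toDual ℝ E).symm L)
        (map_zero _)
    have hgi : Integrable (gradient θ) := hgc.integrable_of_hasCompactSupport hgs
    have i1 : Integrable fun x => ⟪u t x, gradient θ x⟫ :=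
      integrable_inner_of_aestronglyMeasurable_of_norm_le (hmeas t ht) (hM t ht) hgi
    have i2 : Integrable fun x => ⟪d t • e, gradient θ x⟫ := hgi.const_inner _
    calc ∫ x, ⟪u t x + d t • e, gradient θ x⟫
        = (∫ x, ⟪u t x, gradient θ x⟫) + ∫ x, ⟪d t • e, gradient θ x⟫ := by
          rw [← integral_add i1 i2]
          exact integral_congr_ae (Eventually.of_forall fun x => by simp only [inner_add_left])
      _ = 0 := by
          rw [hu.1.1 t ht θ hθ, (VectorCalculus.IsDivFree.isWeaklyDivFree_holds (u := fun _ : E => d t • e)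
            (fun x => by simp [VectorCalculus.divergence]) contDiff_const) θ hθ, add_zero]
  · -- the two-time identity
    have hs : s < 0 := hst.trans ht
    have key := hu.1.2 s t hst ht φ hφ hdiv
    have hφ1 : ContDiff ℝ 1 φ := hφ.contDiff.of_le (by exact_mod_cast le_top)
    have hφi : Integrable φ := hφ.contDiff.continuous.integrable_of_hasCompactSupport hφ.hasCompactSupport
    have e1 : ∫ x, ⟪u t x + d t • e, φ x⟫ = ∫ x, ⟪u t x, φ x⟫ := by
      have i1 := integrable_inner_of_aestronglyMeasurable_of_norm_le (hmeas t ht) (hM t ht) hφi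
      have i2 : Integrable fun x => ⟪d t • e, φ x⟫ := hφi.const_inner _
      rw [show (fun x => ⟪u t x + d t • e, φ x⟫) = fun x => ⟪u t x, φ x⟫ + ⟪d t • e, φ x⟫ from
        funext fun x => inner_add_left _ _ _, integral_add i1 i2,
        integral_inner_const_eq_zero_of_isDivFree (d t • e) hφ1 hφ.hasCompactSupport hdiv, add_zero]
    have e2 : ∫ x, ⟪u s x + d s • e, heatTest ν φ (t - s) x⟫ = ∫ x, ⟪u s x, heatTest ν φ (t - s) x⟫ := by
      have hψi : Integrable (heatTest ν φ (t - s)) := integrable_heatFlow hφi _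
      have i1 := integrable_inner_of_aestronglyMeasurable_of_norm_le (hmeas s hs) (hM s hs) hψi
      have i2 : Integrable fun x => ⟪d s • e, heatTest ν φ (t - s) x⟫ := hψi.const_inner _
      have h0 : ∫ x, ⟪d s • e, heatTest ν φ (t - s) x⟫ = 0 := by
        rw [show heatTest ν φ (t - s) = heatFlow φ (ν * (t - s)) from rfl,
          integral_inner_const_heatFlow hφi,
          integral_inner_const_eq_zero_of_isDivFree (d s • e) hφ1 hφ.hasCompactSupport hdiv]
      rw [show (fun x => ⟪u s x + d s • e, heatTest ν φ (t - s) x⟫) =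
          fun x => ⟪u s x, heatTest ν φ (t - s) x⟫ + ⟪d s • e, heatTest ν φ (t - s) x⟫ from
        funext fun x => inner_add_left _ _ _, integral_add i1 i2, h0, add_zero]
    have e3 : (∫ τ in s..t, ∫ x, ⟪u τ x + d τ • e,
        convect (fun y => u τ y + d τ • e) (heatTest ν φ (t - τ)) x⟫) =
        ∫ τ in s..t, ∫ x, ⟪u τ x, convect (u τ) (heatTest ν φ (t - τ)) x⟫ := by
      refine intervalIntegral.integral_congr_ae ?_
      have hinv' := (ae_restrict_iff' (measurableSet_Iio : MeasurableSet (Iio (0 : ℝ)))).1 hinv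
      filter_upwards [hinv'] with τ hτ hτmem
      rw [uIoc_of_le hst.le] at hτmem
      have hτ0 : τ < 0 := hτmem.2.trans_lt ht
      rcases hτ hτ0 with h0 | hinvτ
      · simp [h0]
      · exact integral_inner_convect_heatTest_add_const_eq (hmeas τ hτ0) (hM τ hτ0) (hu.1.1 τ hτ0)
          hinvτ (d τ) hφ ν (t - τ)
    show ∫ x, ⟪u t x + d t • e, φ x⟫ = (∫ x, ⟪u s x + d s • e, heatTest ν φ (t - s) x⟫) +
        (∫ τ in s..t, ∫ x, ⟪u τ x + d τ • e,
          convect (fun y => u τ y + d τ • e) (heatTest ν φ (t - τ)) x⟫) +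
        ∫ τ in s..t, ∫ x, ⟪(0 : ℝ → E → E) τ x, heatTest ν φ (t - τ) x⟫
    rw [e1, e2, e3]
    exact key
  · -- the bound
    calc ‖u t x + d t • e‖ ≤ ‖u t x‖ + ‖d t • e‖ := norm_add_le _ _
      _ ≤ M + D * ‖e‖ := add_le_add (hM t ht x) (by
          rw [norm_smul, Real.norm_eq_abs]
          exact mul_le_mul_of_nonneg_right (hD t ht) (norm_nonneg _))

/-- **Time-dependent spatial constants are ancient mild solutions of the duality-form class**, for
*every* `b : ℝ → E` — measurable or not — and every `ν`: every slice is weakly divergence free, the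
two pairings of the identity vanish (divergence-free tests and their caloric extensions have zero
mean, `integral_inner_const_eq_zero_of_isDivFree`, `integral_inner_const_heatFlow`), and the
nonlinear integrand vanishes identically (`integral_inner_const_fderiv_heatFlow_eq_zero`). These
are the "parasitic solutions" `u(x,t) = b(t)` of KNSS 2009, §1 p. 3; for a non-measurable bounded
`b` the field is not a.e. equal to any element of `L^∞(E × (−∞, 0))`, which is why the slice-wise
class of `Literature.Analysis.FluidPDE.knss_axisymmetric_no_swirl` is strictly larger than the
printed one. [cite: KochNadirashviliSereginSverak2009, §1 p. 3 (parasitic solutions u(x,t) = b(t))] -/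
theorem isAncientMildSolution_timeConst (ν : ℝ) (b : ℝ → E) :
    IsAncientMildSolution ν (fun t _ => b t) := by
  refine ⟨fun t _ => VectorCalculus.IsDivFree.isWeaklyDivFree_holds (u := fun _ : E => b t)
    (fun x => by simp [VectorCalculus.divergence]) contDiff_const, fun s t _ _ φ hφ hdiv => ?_⟩
  have hφ1 : ContDiff ℝ 1 φ := hφ.contDiff.of_le (by exact_mod_cast le_top)
  have hφi : Integrable φ := hφ.contDiff.continuous.integrable_of_hasCompactSupport hφ.hasCompactSupport
  have h1 : ∫ x, ⟪b t, φ x⟫ = 0 := integral_inner_const_eq_zero_of_isDivFree (b t) hφ1 hφ.hasCompactSupport hdiv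
  have h2 : ∫ x, ⟪b s, heatTest ν φ (t - s) x⟫ = 0 := by
    rw [show heatTest ν φ (t - s) = heatFlow φ (ν * (t - s)) from rfl, integral_inner_const_heatFlow hφi,
      integral_inner_const_eq_zero_of_isDivFree (b s) hφ1 hφ.hasCompactSupport hdiv]
  have h3 : ∀ τ, ∫ x, ⟪b τ, convect (fun _ : E => b τ) (heatTest ν φ (t - τ)) x⟫ = 0 := fun τ => by
    simp only [convect_apply]
    exact integral_inner_const_fderiv_heatFlow_eq_zero hφ1 hφ.hasCompactSupport _ _ _
  show ∫ x, ⟪b t, φ x⟫ = (∫ x, ⟪b s, heatTest ν φ (t - s) x⟫) +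
      (∫ τ in s..t, ∫ x, ⟪b τ, convect (fun _ : E => b τ) (heatTest ν φ (t - τ)) x⟫) +
      ∫ τ in s..t, ∫ x, ⟪(0 : ℝ → E → E) τ x, heatTest ν φ (t - τ) x⟫
  simp only [h1, h2, h3, Pi.zero_apply, inner_zero_left, integral_zero, intervalIntegral.integral_zero,
    add_zero]

/-- **Bounded time-dependent spatial constants are bounded ancient mild solutions**, for every
`b : ℝ → E` bounded on `t < 0` (no measurability) and every `ν` — the class-gap witness of
`Literature.Analysis.FluidPDE.knss2009_axisymmetric_no_swirl` (docstring) made formal.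
[cite: KochNadirashviliSereginSverak2009, §1 p. 3 (parasitic solutions u(x,t) = b(t))] -/
theorem isBoundedAncientMildSolution_timeConst (ν : ℝ) {b : ℝ → E} (hb : ∃ B : ℝ, ∀ t < 0, ‖b t‖ ≤ B) :
    IsBoundedAncientMildSolution ν (fun t _ => b t) := by
  obtain ⟨B, hB⟩ := hb
  exact ⟨isAncientMildSolution_timeConst ν b, ⟨B, fun t ht _ => hB t ht⟩⟩

end Drift

end Literature.Analysis.FluidPDE
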